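import Summits.AtomisticToContinuum.FouriersLaw.Theorems.OddSectorIrreversibilityCorrectorTheorySmooth
import HarnessLib

/-!
# `HiddenChargeMazur.StaticKubo`, line `birth` (rev 4), stub `stub_correctorLipschitz` — aux:
the dyadic decomposition of the Kubo corrector

Helper file (`--supports stmt-AtomisticToContinuum-13510`, crux decl `HiddenChargeMazur.StaticKubo`,
registered aux stub `stub_correctorLipschitz_dyadicPackage` of the skeleton
`Cruxes/StaticKubo/Lines/birth.lean`, rev 4).

For the pinned anharmonic chain `pinnedChain ω₂ lam β γ` (all parameters `> 0`), `N ≥ 1`, both baths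
at `T > 0`, equilibrium kernels `P_t = transitionKernel N T T t`, total current `J = Σ_i bondCurrent i`,
`g t x = P_{t⁺}J(x)` and the dyadic pieces `φ_n(x) = ∫_{(n,n+1]} g t x dt` of the Kubo corrector
`u⋆(x) = ∫_{(0,∞)} g t x dt`: for every `0 < ϑ < 1/T` there are `M ≥ 0`, `C, c > 0` with

* `|φ_n(x)| ≤ M C e^{-cn} e^{ϑH(x)}` (CEHR (2.5): `|P_tJ| ≤ MCe^{ϑH}e^{-ct}`, `totalBondCurrent_decay`);
* `t ↦ g t x` is integrable on `(0,∞)`;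
* the SEMIGROUP STEP `P_1 φ_n = φ_{n+1}` pointwise (Chapman–Kolmogorov `P_{1+t} = P_t ∘ P_1`,
  Fubini on `(n,n+1] × P_1(x,·)` with the majorant `MC e^{-ct} e^{ϑH}` and the moment bound (3.4),
  translation `t ↦ t+1`);
* `u⋆(x) = Σ_n φ_n(x)` (`(0,∞) = ⋃_n (n,n+1]` disjointly, absolute convergence).

References: Cuneo–Eckmann–Hairer–Rey-Bellet, EJP 23 (2018) no. 55, Thm 2.13 eq. (2.5), §3 eq. (3.4);
Kundu–Dhar–Narayan, J. Stat. Mech. (2009) L03001 (the Kubo corrector). Nothing here closes the item.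
-/

noncomputable section

open MeasureTheory Filter Topology
open scoped NNReal ENNReal ProbabilityTheory
open Literature.MathematicalPhysics.KineticTheory.HeatConduction Literature.MathematicalPhysics.KineticTheory
open Literature.Probability.Process OscillatorChain
open Summit.AtomisticToContinuum.FouriersLaw.Theorems.OddSectorIrreversibility.Corrector
open Summit.AtomisticToContinuum.FouriersLaw.Theorems.ExtensiveSnapshotIrreversibility.ClausiusBudget

namespace Summit.AtomisticToContinuum.FouriersLaw.Cruxes.StaticKubo.Birth.Stubs

/-- `(0,∞) = ⋃_{n ∈ ℕ} (n, n+1]` in `ℝ`. [folklore] -/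
theorem iUnion_Ioc_natCast_eq_Ioi : (⋃ n : ℕ, Set.Ioc (n : ℝ) (n + 1)) = Set.Ioi 0 := by
  ext t
  simp only [Set.mem_iUnion, Set.mem_Ioc, Set.mem_Ioi]
  constructor
  · rintro ⟨n, hn, -⟩
    exact n.cast_nonneg.trans_lt hn
  · intro ht
    have h1 : 1 ≤ ⌈t⌉₊ := Nat.ceil_pos.2 ht
    refine ⟨⌈t⌉₊ - 1, ?_, ?_⟩
    · rw [Nat.cast_sub h1, Nat.cast_one]
      have := Nat.ceil_lt_add_one ht.le
      linarith
    · rw [Nat.cast_sub h1, Nat.cast_one, sub_add_cancel]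
      exact Nat.le_ceil t

/-- The intervals `(n, n+1]`, `n ∈ ℕ`, are pairwise disjoint. [folklore] -/
theorem pairwise_disjoint_Ioc_natCast :
    Pairwise (Function.onFun Disjoint fun n : ℕ => Set.Ioc (n : ℝ) (n + 1)) := by
  rw [pairwise_disjoint_on]
  intro m n hmn
  refine Set.disjoint_left.2 fun t htm htn => ?_
  have h : (m : ℝ) + 1 ≤ n := by exact_mod_cast hmn
  exact absurd (htm.2.trans h) (not_le.2 htn.1)

/-- **Aux stub — the dyadic decomposition of the Kubo corrector** (for `stub_correctorLipschitz`).
For the pinned chain (all parameters `> 0`), `N ≥ 1`, `T > 0`, `0 < ϑ < 1/T`, with `g t x = P_{t⁺}J(x)`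
and `φ_n(x) = ∫_{(n,n+1]} g t x dt`: there are `M ≥ 0`, `C, c > 0` with `|φ_n| ≤ MCe^{-cn}e^{ϑH}`,
`t ↦ g t x ∈ L¹((0,∞))`, the semigroup step `P_1φ_n = φ_{n+1}` (Chapman–Kolmogorov + Fubini +
translation) and `u⋆ = Σ_n φ_n` pointwise. [cite: CuneoEckmannHairerReyBellet2018, Thm 2.13 eq. (2.5)] -/
theorem stub_correctorLipschitz_dyadicPackage :
    ∀ ω₂ lam β γ : ℝ, 0 < ω₂ → 0 < lam → 0 < β → 0 < γ → ∀ N : ℕ, 0 < N → ∀ T : ℝ, 0 < T →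
      ∀ ϑ : ℝ, 0 < ϑ → ϑ < 1 / T →
      ∀ g : ℝ → PhaseSpace N → ℝ,
        g = (fun t x => ∫ z, (∑ i : Fin N, (pinnedChain ω₂ lam β γ).bondCurrent N i z)
          ∂((pinnedChain ω₂ lam β γ).transitionKernel N T T t.toNNReal x)) →
      ∀ φ : ℕ → PhaseSpace N → ℝ, φ = (fun (n : ℕ) (x : PhaseSpace N) => ∫ t in Set.Ioc (n : ℝ) (n + 1), g t x) →
      ∃ M C c : ℝ, 0 ≤ M ∧ 0 < C ∧ 0 < c ∧
        (∀ (n : ℕ) (x : PhaseSpace N),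
          |φ n x| ≤ M * C * Real.exp (-c * n) * Real.exp (ϑ * (pinnedChain ω₂ lam β γ).hamiltonian N x)) ∧
        (∀ x : PhaseSpace N, IntegrableOn (fun t => g t x) (Set.Ioi (0 : ℝ))) ∧
        (∀ (n : ℕ) (x : PhaseSpace N),
          ∫ y, φ n y ∂((pinnedChain ω₂ lam β γ).transitionKernel N T T 1 x) = φ (n + 1) x) ∧
        (∀ x : PhaseSpace N, HasSum (fun n => φ n x) (∫ t in Set.Ioi (0 : ℝ), g t x)) := by
  intro ω₂ lam β γ hω hl hβ hγ N hN T hT ϑ hϑ hϑT g hg φ hφ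
  set P := pinnedChain ω₂ lam β γ with hP
  set κ := P.transitionKernel N T T with hκ
  set H := P.hamiltonian N with hH
  set J : PhaseSpace N → ℝ := fun y => ∑ i : Fin N, P.bondCurrent N i y with hJ
  haveI hMk : ∀ t, ProbabilityTheory.IsMarkovKernel (κ t) := fun t =>
    pinnedChain_isMarkovKernel_transitionKernel hω hl.le hβ.le hγ.le N T T t
  obtain ⟨M, C, c, hM, hC, hc, hJM, hdecay⟩ := totalBondCurrent_decay hω hl hβ hγ hT hN hϑ hϑT
  have hJc : Continuous J := continuous_totalBondCurrent ω₂ lam β γ N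
  have hg_apply : ∀ t x, g t x = ∫ z, J z ∂(κ t.toNNReal x) := fun t x => by rw [hg]
  have hφ_apply : ∀ n x, φ n x = ∫ t in Set.Ioc (n : ℝ) (n + 1), g t x := fun n x => by rw [hφ]
  -- the weight `e^{ϑH}` and integrability of `J` under the kernels
  have hVint : ∀ (t : ℝ≥0) (z : PhaseSpace N), Integrable (fun y => Real.exp (ϑ * H y)) (κ t z) :=
    fun t z => integrable_exp_mul_hamiltonian_transitionKernel hω hl hβ hγ hT hN hϑ hϑT t z
  have hJint : ∀ (t : ℝ≥0) (z : PhaseSpace N), Integrable J (κ t z) := fun t z =>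
    ((hVint t z).const_mul M).mono' hJc.aestronglyMeasurable
      (Eventually.of_forall fun y => by rw [Real.norm_eq_abs]; exact hJM y)
  -- joint measurability of `(t, x) ↦ g t x`
  set S := pinnedChainSemigroup hω hl.le hβ.le hγ.le hN hT.le hT.le with hS
  have hSM : StronglyMeasurable (Function.uncurry g) := by
    have h := (S.stronglyMeasurable_uncurry_act hJc.stronglyMeasurable).comp_measurable
      measurable_swap
    rw [hg]
    exact h
  have hSMx : ∀ x : PhaseSpace N, StronglyMeasurable fun t => g t x := fun x =>
    hSM.comp_measurable measurable_prodMk_right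
  -- the decay bound for all real times
  have hgb : ∀ (t : ℝ) (x : PhaseSpace N),
      |g t x| ≤ M * C * Real.exp (ϑ * H x) * Real.exp (-c * t) := by
    intro t x
    rw [hg_apply]
    refine (hdecay x t.toNNReal).trans ?_
    refine mul_le_mul_of_nonneg_left (Real.exp_le_exp.2 ?_) (by positivity)
    have : t ≤ (t.toNNReal : ℝ) := Real.le_coe_toNNReal t
    nlinarith
  have hbound : ∀ x t, ‖g t x‖ ≤ M * C * Real.exp (ϑ * H x) * Real.exp (-c * t) := fun x t => by
    rw [Real.norm_eq_abs]; exact hgb t x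
  have hmaj : ∀ x : PhaseSpace N,
      IntegrableOn (fun t => M * C * Real.exp (ϑ * H x) * Real.exp (-c * t)) (Set.Ioi (0 : ℝ)) :=
    fun x => (exp_neg_integrableOn_Ioi 0 hc).const_mul _
  -- (A) absolute convergence of the Kubo integral
  have hA : ∀ x : PhaseSpace N, IntegrableOn (fun t => g t x) (Set.Ioi (0 : ℝ)) := fun x =>
    Integrable.mono' (hmaj x) (hSMx x).aestronglyMeasurable (Eventually.of_forall (hbound x))
  -- (i) the value bound of the dyadic pieces
  have hval : ∀ (n : ℕ) (x : PhaseSpace N),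
      |φ n x| ≤ M * C * Real.exp (-c * n) * Real.exp (ϑ * H x) := by
    intro n x
    rw [hφ_apply, ← Real.norm_eq_abs]
    have hlt : (volume : Measure ℝ) (Set.Ioc (n : ℝ) (n + 1)) < ∞ := measure_Ioc_lt_top
    calc ‖∫ t in Set.Ioc (n : ℝ) (n + 1), g t x‖
        ≤ (M * C * Real.exp (-c * n) * Real.exp (ϑ * H x)) *
            (volume : Measure ℝ).real (Set.Ioc (n : ℝ) (n + 1)) :=
          norm_setIntegral_le_of_norm_le_const hlt fun t ht => by
            calc ‖g t x‖ ≤ M * C * Real.exp (ϑ * H x) * Real.exp (-c * t) := hbound x t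
              _ ≤ M * C * Real.exp (ϑ * H x) * Real.exp (-c * n) := by
                  refine mul_le_mul_of_nonneg_left (Real.exp_le_exp.2 ?_) (by positivity)
                  have := ht.1
                  nlinarith
              _ = _ := by ring
      _ = _ := by rw [Real.volume_real_Ioc_of_le (by linarith), add_sub_cancel_left, mul_one]
  -- Chapman–Kolmogorov: `P_{u+1} J = P_1 (P_u J)`
  have hCK : ∀ u : ℝ, 0 ≤ u → ∀ x : PhaseSpace N, g (u + 1) x = ∫ y, g u y ∂(κ 1 x) := by
    intro u hu x
    have hadd : κ (u + 1).toNNReal = κ u.toNNReal ∘ₖ κ 1 := by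
      rw [Real.toNNReal_add hu zero_le_one, Real.toNNReal_one, add_comm, hκ,
        pinnedChain_transitionKernel_add hω hl.le hβ.le hγ.le N T T]
    rw [hg_apply, hadd]
    simp_rw [hg_apply]
    exact ProbabilityTheory.Kernel.integral_comp (by rw [← hadd]; exact hJint _ x)
  -- translation `t = u + 1`
  have htrans : ∀ (n : ℕ) (x : PhaseSpace N),
      ∫ t in Set.Ioc ((n : ℝ) + 1) ((n : ℝ) + 1 + 1), g t x =
        ∫ u in Set.Ioc (n : ℝ) (n + 1), g (u + 1) x := by
    intro n x
    have h := (measurePreserving_add_right (volume : Measure ℝ) 1).setIntegral_preimage_emb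
      (measurableEmbedding_addRight 1) (fun t => g t x) (Set.Ioc ((n : ℝ) + 1) ((n : ℝ) + 1 + 1))
    rw [Set.preimage_add_const_Ioc, add_sub_cancel_right, add_sub_cancel_right] at h
    exact h.symm
  -- Fubini on `(n,n+1] × P_1(x,·)`
  have hFub : ∀ (n : ℕ) (x : PhaseSpace N),
      ∫ u in Set.Ioc (n : ℝ) (n + 1), ∫ y, g u y ∂(κ 1 x) = ∫ y, φ n y ∂(κ 1 x) := by
    intro n x
    have hprod : Integrable (Function.uncurry g)
        ((volume.restrict (Set.Ioc (n : ℝ) (n + 1))).prod (κ 1 x)) := by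
      refine Integrable.mono'
        ((Integrable.mul_prod ((exp_neg_integrableOn_Ioi (n : ℝ) hc).mono_set Set.Ioc_subset_Ioi_self)
          (hVint 1 x)).const_mul (M * C)) hSM.aestronglyMeasurable (Eventually.of_forall fun p => ?_)
      calc ‖Function.uncurry g p‖ = ‖g p.1 p.2‖ := rfl
        _ ≤ M * C * Real.exp (ϑ * H p.2) * Real.exp (-c * p.1) := hbound p.2 p.1
        _ = M * C * (Real.exp (-c * p.1) * Real.exp (ϑ * H p.2)) := by ring
    simp_rw [hφ_apply]
    exact integral_integral_swap hprod
  -- (ii) the semigroup step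
  have hstep : ∀ (n : ℕ) (x : PhaseSpace N), ∫ y, φ n y ∂(κ 1 x) = φ (n + 1) x := by
    intro n x
    rw [hφ_apply (n + 1) x, Nat.cast_add_one, htrans n x, ← hFub n x]
    refine (setIntegral_congr_fun measurableSet_Ioc fun u hu => hCK u ?_ x).symm
    exact (n.cast_nonneg).trans hu.1.le
  -- (iv) `u⋆ = Σ_n φ_n`
  have hsum : ∀ x : PhaseSpace N, HasSum (fun n => φ n x) (∫ t in Set.Ioi (0 : ℝ), g t x) := by
    intro x
    have hAU : IntegrableOn (fun t => g t x) (⋃ n : ℕ, Set.Ioc (n : ℝ) (n + 1)) := by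
      rw [iUnion_Ioc_natCast_eq_Ioi]; exact hA x
    have h := hasSum_integral_iUnion (μ := (volume : Measure ℝ)) (f := fun t => g t x)
      (fun n => measurableSet_Ioc) pairwise_disjoint_Ioc_natCast hAU
    rw [iUnion_Ioc_natCast_eq_Ioi] at h
    refine h.congr_fun ?_
    intro n
    exact (hφ_apply n x)
  exact ⟨M, C, c, hM, hC, hc, hval, hA, hstep, hsum⟩

end Summit.AtomisticToContinuum.FouriersLaw.Cruxes.StaticKubo.Birth.Stubs

end
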